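import Summits.Ventures.GridStability.Lyapunov.ClassicalSwingForward
import Summits.Ventures.GridStability.Models.LosslessVariantsAnyDamping
import Summits.Ventures.GridStability.Models.StructurePreservingClassical
import Literature.MathematicalPhysics.PowerSystems.LosslessMultimachineDichotomy
import HarnessLib

/-!
# GridStability/Models/ClassicalSwingLosslessDichotomy — model-1's classical network-reduced model
# `M_cl` (lossless reading) AS lit-6's `LosslessSystem n 0`, and ★ #93 «G2-LOSSLESS-DICHOTOMY-THM»
# read BY NAME on it and on the typed lossless objects of record WSCC9L / NE39L (any damping profile):
# from every machine state exactly one global motion; along it EITHER some rotor-angle difference is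
# unbounded OR every speed deviation → ω_s = ΣP′/ΣD and every power mismatch → 0

Venture GRIDFUSION (LADDER-GRIDFUSION G3 model row → G2), cell `run/shared/lean/pub/gridfusion/`, seat
gridfusion-model-1 (g7); lead g7 RULING 9b (GO «CS-LOSSLESS-DICHOTOMY», one module). THE GAP IT FILLS:
★ #93 (lit-1, `Literature/MathematicalPhysics/PowerSystems/LosslessMultimachineDichotomy.lean`, p530029 +
§8–§11 p533795) is proved on lit-6's ABSTRACT record `ClassicalModel.LosslessSystem n m`; no Summits file
constructed that record from the TYPED models (`Models/ClassicalSwing.lean` p459650 and its `RecastData`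
instances) — the tree used only `LosslessSystem.vtGap`. This file is the model-1-row BRIDGE (same role as
`SMIB.toLit` p479609 / `ClassicalSwing.toLitNode` p493501) plus the sentences it transports. NO new
analysis: every limit statement is lit-1's theorem instantiated through the bridge; well-posedness is
lyap-2's `ClassicalSwingGlobal` (p518035) / lyap-1's `ClassicalSwingForward` (`existsUnique_and_forall`).

CONTENTS. `ClassicalSwing.toLossless p : LosslessSystem n 0` (the same numbers: `M`, `D`, net powers
`P′_i = P_i − E_i²G_ii`, couplings `C_ij = E_iE_jB_ij` off the diagonal, no bus); `toLossless_flow` /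
`toLossless_field` — for LOSSLESS `p` **the two vector fields COINCIDE** on the common phase space
`State n`; `IsSolutionOn.toLossless(_Icc)` (solutions are the same curves); `syncFreq p = ΣP′/ΣD`;
THE SENTENCES for lossless `p`, `M_i, D_i > 0`, `B` reciprocal: `lossless_dichotomy` (along every global
solution EITHER `∀ B ∃ t ≥ 0 ∃ i j, B < |δ_i(t) − δ_j(t)|` OR every `ω_i → ω_s` and every
`P_i − D_iω_s − P_ei(δ(t)) → 0`), `lossless_sync_of_cohesive` (bounded differences ⇒ the synchronised
branch), `lossless_dichotomy_of_state` (`∃!` packaging, from EVERY machine state). FAMILY READING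
(model-3's `RecastData.toModelD D a′`: injections `P′_i + M_ia′`, ANY damping profile `D`):
`RecastData.sum_Pprime_sub_self_eq_zero` (lossless reciprocal data ⇒ `Σ_i (P′_i − E_i²G_ii) = 0` EXACTLY,
antisymmetric summand, no `EqData`), `syncFreq_toModelD` (`ω_s = a′·ΣM/ΣD` in closed form),
`dichotomy_toModelD`, `sync_of_cohesive_toModelD`. INSTANCES, data side conditions by `decide`:
`WSCC9.postB_relL_dichotomy_anyDamping` / `…_sync_of_cohesive` (3 machines, `WSCC9.postB_relL` p485370) and
`NE39L.data_dichotomy_anyDamping` / `…_sync_of_cohesive` (10 machines, `NE39L.data` p486685). The energy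
identities (lit-6 `V` = model-1 `energy δˢ` + const, dissipation `−ΣD_iω_i²`, work form of the dichotomy,
uniform-λ readings) follow in `Models/ClassicalSwingLosslessEnergy.lean`.

THREE COLUMNS (never merged). CERTIFIED (kernel, standard axioms): «in MODEL `M_cl`-lossless (model-1's
`ClassicalSwing n` with `IsLossless`; instances `M_cl`(WSCC9L-postB) / `M_cl`(NE39L-h12) with injections
`P′_i + M_ia′` under ANY damping profile `D_i > 0`) from EVERY machine state there is exactly one global
motion, and along it EITHER some rotor-angle difference is unbounded on `t ≥ 0` OR every speed deviation
→ `ω_s` (`= a′·ΣM/ΣD` for the instances) and every mismatch `P_i − D_iω_s − P_ei(δ(t)) → 0`». VALIDATED: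
nothing here (★ #93's referee RK4 illustrations apply). MODELLED: MV-2/MV-2L (transfer conductances
NEGLECTED; the instances are SYNTHETIC lossless variants + MV-RD/MV-h12/MV-E6, NOT the printed WSCC 9-bus /
New England systems); `D_i > 0` load-bearing; which alternative holds from a given state is NOT claimed;
never a region, never «the grid synchronises». One bookkeeping definition (`toLossless`) + one displayed
quotient (`syncFreq`); no named fact; no `sorry`; no kit.
-/

noncomputable section

open Real Set Filter Finset
open scoped Topology
open Literature.MathematicalPhysics.PowerSystems.ClassicalModel

namespace Summit.Ventures.GridStability.Models

namespace ClassicalSwing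

variable {n : ℕ} (p : ClassicalSwing n)

/-! ### The bridge: `M_cl` read as lit-6's `LosslessSystem n 0` -/

/-- **`M_cl` AS lit-6's lossless record (no infinite bus).** Inertias `M_i`, dampings `D_i`, net powers
`P′_i = P_i − E_i²G_ii` (the constant-impedance self term moved to the left, Sauer–Pai's `P_i′`), couplings
`C_ij = E_iE_jB_ij` for `i ≠ j` and `0` on the diagonal (the self-susceptance never couples), `m = 0`
buses. Bookkeeping only: the same numbers.
[cite: SauerPai1998, §7.9.3 eqs. (7.212)–(7.216); VuTuritsyn2016, §II eq. (1)] -/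
def toLossless : LosslessSystem n 0 where
  M := p.M
  D := p.D
  P := fun i => p.P i - p.E i ^ 2 * p.G i i
  C := fun i j => if i = j then 0 else p.Ccoef i j
  K := fun _ b => b.elim0
  β := fun b => b.elim0

/-- Inertias of the reading. [cite: SauerPai1998, §7.9.3 eq. (7.216)] -/
@[simp] theorem toLossless_M (i : Fin n) : p.toLossless.M i = p.M i := rfl

/-- Dampings of the reading. [cite: SauerPai1998, §5.7 eq. (5.157)] -/
@[simp] theorem toLossless_D (i : Fin n) : p.toLossless.D i = p.D i := rfl

/-- Net powers of the reading: `P′_i = P_i − E_i²G_ii`. [cite: SauerPai1998, §7.9.3 eq. (7.212)] -/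
@[simp] theorem toLossless_P (i : Fin n) : p.toLossless.P i = p.P i - p.E i ^ 2 * p.G i i := rfl

/-- Couplings of the reading: `C_ij` off the diagonal, `0` on it. [cite: SauerPai1998, §7.9.3 eq. (7.213)] -/
theorem toLossless_C (i j : Fin n) : p.toLossless.C i j = if i = j then 0 else p.Ccoef i j := rfl

/-- The reading's coupling matrix is symmetric (reciprocal `B`; model-2's `Params.Ccoef_symm`, p-file
`StructurePreservingClassical`) — hypothesis `hC` of every theorem of ★ #93. [cite: SauerPai1998, §7.9.3 eq. (7.213)] -/
theorem toLossless_C_symm (hB : ∀ i j, p.B i j = p.B j i) : ∀ i j, p.toLossless.C i j = p.toLossless.C j i := by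
  intro i j
  simp only [toLossless_C]
  by_cases h : i = j
  · subst h; rfl
  · rw [if_neg h, if_neg (Ne.symm h), StructurePreserving.Params.Ccoef_symm p hB]

/-- **Lossless flows agree.** For lossless `M_cl` (`G_ij = 0`, `i ≠ j`) lit-6's electrical flow
`Σ_j C_ij sin(δ_i − δ_j)` is model-1's `P_ei(δ) − E_i²G_ii` (Sauer–Pai (7.212) without transfer-conductance
terms). [cite: SauerPai1998, §7.9.3 eq. (7.212); VuTuritsyn2016, §II eq. (1)] -/
theorem toLossless_flow (hl : p.IsLossless) (θ : Fin n → ℝ) (i : Fin n) :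
    p.toLossless.flow θ i = p.Pe θ i - p.E i ^ 2 * p.G i i := by
  classical
  have h1 : p.toLossless.flow θ i = ∑ j, (if i = j then 0 else p.Ccoef i j) * sin (θ i - θ j) := by
    simp [LosslessSystem.flow, toLossless_C]
  have h2 : ∑ j, (if i = j then 0 else p.Ccoef i j) * sin (θ i - θ j) =
      ∑ j ∈ univ.erase i, p.Ccoef i j * sin (θ i - θ j) := by
    rw [← Finset.add_sum_erase univ _ (mem_univ i), if_pos rfl, zero_mul, zero_add]
    exact Finset.sum_congr rfl fun j hj => by rw [if_neg (Finset.ne_of_mem_erase hj).symm]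
  have h3 : p.Pe θ i - p.E i ^ 2 * p.G i i = ∑ j ∈ univ.erase i, p.Ccoef i j * sin (θ i - θ j) := by
    unfold Pe
    rw [add_sub_cancel_left]
    refine Finset.sum_congr rfl fun j hj => ?_
    have hij : i ≠ j := (Finset.ne_of_mem_erase hj).symm
    simp [Dcoef, hl i j hij]
  rw [h1, h2, h3]

/-- **The two vector fields COINCIDE** (lossless `M_cl`): lit-6's `(ω, (P′ − Dω − flow)/M)` is model-1's
`(ω, (P − P_e(δ) − Dω)/M)` at every phase point. [cite: SauerPai1998, §7.9.3 eqs. (7.215)–(7.216); VuTuritsyn2016, §II eq. (1)] -/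
theorem toLossless_field (hl : p.IsLossless) : p.toLossless.field = p.field := by
  funext x
  refine Prod.ext rfl (funext fun i => ?_)
  show (p.toLossless.P i - p.toLossless.D i * x.2 i - p.toLossless.flow x.1 i) / p.toLossless.M i =
    (p.P i - p.Pe x.1 i - p.D i * x.2 i) / p.M i
  rw [p.toLossless_flow hl, toLossless_P, toLossless_D, toLossless_M]
  ring

/-! ### Solutions correspond (the same curves) -/

/-- A solution of `M_cl` on a time set solves lit-6's field within that set (lossless).
[cite: SauerPai1998, §7.9.3 eqs. (7.215)–(7.216)] -/
theorem IsSolutionOn.toLossless (hl : p.IsLossless) {c : ℝ → State n} {s : Set ℝ}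
    (hc : p.IsSolutionOn c s) : ∀ t ∈ s, HasDerivWithinAt c (p.toLossless.field (c t)) s t := by
  intro t ht
  rw [p.toLossless_field hl]
  exact hc t ht

/-- A GLOBAL solution of `M_cl` is a forward-global motion of lit-6's record in ★ #93's convention
(within `[0, T]` for every `T`). [cite: SauerPai1998, §7.9.3 eqs. (7.215)–(7.216); Teschl2012, Thm. 2.2] -/
theorem IsSolutionOn.toLossless_Icc (hl : p.IsLossless) {c : ℝ → State n} (hc : p.IsSolutionOn c univ) :
    ∀ T : ℝ, ∀ t ∈ Icc 0 T, HasDerivWithinAt c (p.toLossless.field (c t)) (Icc 0 T) t :=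
  fun _ t _ => ((IsSolutionOn.toLossless p hl hc) t (mem_univ t)).mono (subset_univ _)

/-! ### The common frequency and the sentences of ★ #93 on model-1's class -/

/-- The common (synchronous-frame) frequency deviation `ω_s = Σ_i P′_i / Σ_i D_i` of an isolated lossless
network, `P′_i = P_i − E_i²G_ii`. [cite: DorflerBullo2012, arXiv:0910.5673 §5.1 Thm 5.1; SauerPai1998, §6.10 eq. (6.244)] -/
def syncFreq : ℝ := (∑ j, (p.P j - p.E j ^ 2 * p.G j j)) / ∑ j, p.D j

/-- `ω_s` is lit-1's `Σ P / Σ D` of the reading. [cite: DorflerBullo2012, arXiv:0910.5673 §5.1 Thm 5.1] -/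
theorem toLossless_syncFreq : (∑ j, p.toLossless.P j) / ∑ j, p.toLossless.D j = p.syncFreq := rfl

/-- **THE DICHOTOMY on model-1's lossless class (★ #93 §8/§10 by name, frame-correct form).** Lossless
`M_cl`, `M_i > 0`, `D_i > 0`, reciprocal `B`: along EVERY global solution `c = (δ, ω)` EITHER some
rotor-angle difference is unbounded on `t ≥ 0` (`∀ B, ∃ t ≥ 0, ∃ i j, B < |δ_i(t) − δ_j(t)|` — the machines
do not stay together) OR every speed deviation tends to the common frequency `ω_s = Σ P′_i/Σ D_i` and every
mismatch `P_i − D_iω_s − P_ei(δ(t)) → 0`. Which alternative holds is NOT claimed.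
[cite: Chiang1995, §3 Thm 3.1; Leonov2001, Ch. 4 §4.2 Thm 4.1; DorflerBullo2012, arXiv:0910.5673 §5.1 Thm 5.1] -/
theorem lossless_dichotomy (hl : p.IsLossless) (hB : ∀ i j, p.B i j = p.B j i) (hM : ∀ i, 0 < p.M i)
    (hD : ∀ i, 0 < p.D i) {c : ℝ → State n} (hc : p.IsSolutionOn c univ) :
    (∀ B : ℝ, ∃ t, 0 ≤ t ∧ ∃ i j, B < |(c t).1 i - (c t).1 j|) ∨
      ((∀ i, Tendsto (fun t => (c t).2 i) atTop (𝓝 p.syncFreq)) ∧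
        ∀ i, Tendsto (fun t => p.P i - p.D i * p.syncFreq - p.Pe (c t).1 i) atTop (𝓝 0)) := by
  rcases p.toLossless.unbounded_sub_or_quasistatic_syncFrame (p.toLossless_C_symm hB) hM hD
      (IsSolutionOn.toLossless_Icc p hl hc) with ha | ⟨hω, hmis⟩
  · exact Or.inl ha
  · refine Or.inr ⟨hω, fun i => ?_⟩
    refine (hmis i).congr fun t => ?_
    rw [p.toLossless_flow hl, toLossless_syncFreq, toLossless_P, toLossless_D]
    ring

/-- **Bounded angle differences ⇒ frequency synchronisation (★ #93 §10 by name).** Same hypotheses: if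
along a global solution all rotor-angle differences stay bounded on `t ≥ 0` (any bound), then every
`ω_i → ω_s` and every mismatch `P_i − D_iω_s − P_ei(δ(t)) → 0`.
[cite: Leonov2001, Ch. 4 §4.2 Thm 4.1; DorflerBullo2012, arXiv:0910.5673 §5.1 Thm 5.1; Chiang1995, §3 Thm 3.1] -/
theorem lossless_sync_of_cohesive (hl : p.IsLossless) (hB : ∀ i j, p.B i j = p.B j i) (hM : ∀ i, 0 < p.M i)
    (hD : ∀ i, 0 < p.D i) {c : ℝ → State n} (hc : p.IsSolutionOn c univ) {B : ℝ}
    (hcoh : ∀ t, 0 ≤ t → ∀ i j, |(c t).1 i - (c t).1 j| ≤ B) :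
    (∀ i, Tendsto (fun t => (c t).2 i) atTop (𝓝 p.syncFreq)) ∧
      ∀ i, Tendsto (fun t => p.P i - p.D i * p.syncFreq - p.Pe (c t).1 i) atTop (𝓝 0) := by
  obtain ⟨hω, hmis⟩ := p.toLossless.quasistatic_syncFrame_of_cohesive (p.toLossless_C_symm hB) hM hD
    (IsSolutionOn.toLossless_Icc p hl hc) hcoh
  refine ⟨hω, fun i => (hmis i).congr fun t => ?_⟩
  rw [p.toLossless_flow hl, toLossless_syncFreq, toLossless_P, toLossless_D]
  ring

/-- **From EVERY machine state** (`∃!` packaging by `ClassicalSwing.existsUnique_and_forall`): lossless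
`M_cl`, `M_i > 0`, `D_i > 0`, reciprocal `B` — through every `x₀` passes exactly one global solution, and
every global solution through `x₀` satisfies the dichotomy `lossless_dichotomy`.
[cite: Chiang1995, §3 Thm 3.1; Leonov2001, Ch. 4 §4.2 Thm 4.1; Teschl2012, Thm. 2.2 and Cor. 2.6] -/
theorem lossless_dichotomy_of_state (hl : p.IsLossless) (hB : ∀ i j, p.B i j = p.B j i)
    (hM : ∀ i, 0 < p.M i) (hD : ∀ i, 0 < p.D i) (x₀ : State n) :
    (∃! c : ℝ → State n, c 0 = x₀ ∧ p.IsSolutionOn c univ) ∧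
      ∀ c : ℝ → State n, c 0 = x₀ → p.IsSolutionOn c univ →
        ((∀ B : ℝ, ∃ t, 0 ≤ t ∧ ∃ i j, B < |(c t).1 i - (c t).1 j|) ∨
          ((∀ i, Tendsto (fun t => (c t).2 i) atTop (𝓝 p.syncFreq)) ∧
            ∀ i, Tendsto (fun t => p.P i - p.D i * p.syncFreq - p.Pe (c t).1 i) atTop (𝓝 0))) :=
  p.existsUnique_and_forall (I := fun _ => True)
    (fun _ hc _ => p.lossless_dichotomy hl hB hM hD hc) trivial

end ClassicalSwing

namespace RecastData

variable {n : ℕ} (d : RecastData n)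

/-- Bookkeeping: an off-diagonal double sum of an ANTISYMMETRIC rational summand vanishes. [folklore] -/
theorem sum_erase_eq_zero_of_antisymm (g : Fin (n + 1) → Fin (n + 1) → ℚ)
    (hg : ∀ i j, g j i = -g i j) : ∑ i, ∑ j ∈ univ.erase i, g i j = 0 := by
  have hdiag : ∀ i, g i i = 0 := fun i => by have h := hg i i; linarith
  have hfull : ∀ i, ∑ j ∈ univ.erase i, g i j = ∑ j, g i j := fun i => by
    rw [← Finset.add_sum_erase univ _ (mem_univ i), hdiag, zero_add]
  simp only [hfull]
  have hswap : ∑ i, ∑ j, g i j = -∑ i, ∑ j, g i j := by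
    conv_lhs => rw [Finset.sum_comm]
    rw [← Finset.sum_neg_distrib]
    refine Finset.sum_congr rfl fun i _ => ?_
    rw [← Finset.sum_neg_distrib]
    exact Finset.sum_congr rfl fun j _ => hg i j
  linarith

/-- **Lossless reciprocal A1 data: the net injections sum to zero EXACTLY.**
`Σ_i (P′_i − E_i²G_ii) = Σ_i Σ_{j≠i} C_ij (s_ic_j − c_is_j) = 0` (`G_ij = 0` off the diagonal, `B`
reciprocal; the summand is antisymmetric). No `EqData`/circle hypothesis is used.
[cite: SauerPai1998, §7.9.3 eqs. (7.212)–(7.213); DorflerBullo2012, arXiv:0910.5673 §5.1 proof of Thm 5.1] -/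
theorem sum_Pprime_sub_self_eq_zero (hG : ∀ i j, i ≠ j → d.G i j = 0) (hB : ∀ i j, d.B i j = d.B j i) :
    ∑ i, (d.Pprime i - d.E i ^ 2 * d.G i i) = 0 := by
  have hterm : ∀ i, d.Pprime i - d.E i ^ 2 * d.G i i = ∑ j ∈ univ.erase i, d.Cc i j * d.sd i j := by
    intro i
    rw [d.Pprime_eq, add_sub_cancel_left]
    refine Finset.sum_congr rfl fun j hj => ?_
    have hij : i ≠ j := (Finset.ne_of_mem_erase hj).symm
    simp [PeTermEq, Dc, hG i j hij]
  simp only [hterm]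
  refine sum_erase_eq_zero_of_antisymm _ fun i j => ?_
  simp only [Cc, sd, hB j i]
  ring

/-- **Common frequency of the family reading, closed form**: for lossless reciprocal data, ANY damping
profile `D` and any common acceleration `a′`, `ω_s(toModelD D a′) = a′·Σ_i M_i / Σ_i D_i`.
[cite: DorflerBullo2012, arXiv:0910.5673 §5.1 Thm 5.1; SauerPai1998, §6.10 eq. (6.244)] -/
theorem syncFreq_toModelD (hG : ∀ i j, i ≠ j → d.G i j = 0) (hB : ∀ i j, d.B i j = d.B j i)
    (D : Fin (n + 1) → ℝ) (a : ℝ) :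
    (d.toModelD D a).syncFreq = a * (∑ i, (d.M i : ℝ)) / ∑ i, D i := by
  have h0 : ∑ i, ((d.Pprime i : ℝ) - (d.E i : ℝ) ^ 2 * (d.G i i : ℝ)) = 0 := by
    have h := congrArg (fun q : ℚ => (q : ℝ)) (d.sum_Pprime_sub_self_eq_zero hG hB)
    simpa [Rat.cast_sum] using h
  have hnum : ∑ i, ((d.toModelD D a).P i - (d.toModelD D a).E i ^ 2 * (d.toModelD D a).G i i) =
      a * ∑ i, (d.M i : ℝ) := by
    have h1 : ∀ i, (d.toModelD D a).P i - (d.toModelD D a).E i ^ 2 * (d.toModelD D a).G i i =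
        ((d.Pprime i : ℝ) - (d.E i : ℝ) ^ 2 * (d.G i i : ℝ)) + a * (d.M i : ℝ) := by
      intro i
      show ((d.Pprime i : ℝ) + (d.M i : ℝ) * a) - (d.E i : ℝ) ^ 2 * (d.G i i : ℝ) = _
      ring
    simp only [h1, Finset.sum_add_distrib, h0, zero_add, Finset.mul_sum]
  have hden : ∑ i, (d.toModelD D a).D i = ∑ i, D i := rfl
  unfold ClassicalSwing.syncFreq
  rw [hnum, hden]

/-- **THE DICHOTOMY for the family reading of a lossless reciprocal record** (`M_i > 0`, ANY `D_i > 0`,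
any `a′`; ★ #93 by name through `ClassicalSwing.lossless_dichotomy_of_state`): from EVERY machine state
exactly one global motion of `toModelD D a′`, and along it EITHER some rotor-angle difference is unbounded
on `t ≥ 0` OR every `ω_i → a′·ΣM/ΣD` and every `P_i − D_iω_s − P_ei(δ(t)) → 0`.
[cite: Chiang1995, §3 Thm 3.1; Leonov2001, Ch. 4 §4.2 Thm 4.1; DorflerBullo2012, arXiv:0910.5673 §5.1 Thm 5.1] -/
theorem dichotomy_toModelD (hG : ∀ i j, i ≠ j → d.G i j = 0) (hB : ∀ i j, d.B i j = d.B j i)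
    (hM : ∀ i, 0 < d.M i) {D : Fin (n + 1) → ℝ} (hD : ∀ i, 0 < D i) (a : ℝ)
    (x₀ : ClassicalSwing.State (n + 1)) :
    (∃! c : ℝ → ClassicalSwing.State (n + 1), c 0 = x₀ ∧ (d.toModelD D a).IsSolutionOn c univ) ∧
      ∀ c : ℝ → ClassicalSwing.State (n + 1), c 0 = x₀ → (d.toModelD D a).IsSolutionOn c univ →
        ((∀ B : ℝ, ∃ t, 0 ≤ t ∧ ∃ i j, B < |(c t).1 i - (c t).1 j|) ∨
          ((∀ i, Tendsto (fun t => (c t).2 i) atTop (𝓝 (a * (∑ i, (d.M i : ℝ)) / ∑ i, D i))) ∧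
            ∀ i, Tendsto (fun t => (d.toModelD D a).P i - D i * (a * (∑ i, (d.M i : ℝ)) / ∑ i, D i) -
              (d.toModelD D a).Pe (c t).1 i) atTop (𝓝 0))) := by
  have hM' : ∀ i, 0 < (d.toModelD D a).M i := fun i => by
    rw [toModelD_M]; exact_mod_cast hM i
  have h := (d.toModelD D a).lossless_dichotomy_of_state (d.isLossless_toModelD hG D a)
    (fun i j => d.B_symm_toModelD hB D a i j) hM' hD x₀
  rw [d.syncFreq_toModelD hG hB D a] at h
  exact h

/-- **Bounded angle differences ⇒ frequency synchronisation** for the family reading (★ #93 §10 by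
name): same hypotheses; along a global motion of `toModelD D a′` with all `|δ_i − δ_j|` bounded on
`t ≥ 0`, every `ω_i → a′·ΣM/ΣD` and every mismatch `→ 0`.
[cite: Leonov2001, Ch. 4 §4.2 Thm 4.1; DorflerBullo2012, arXiv:0910.5673 §5.1 Thm 5.1] -/
theorem sync_of_cohesive_toModelD (hG : ∀ i j, i ≠ j → d.G i j = 0) (hB : ∀ i j, d.B i j = d.B j i)
    (hM : ∀ i, 0 < d.M i) {D : Fin (n + 1) → ℝ} (hD : ∀ i, 0 < D i) (a : ℝ)
    {c : ℝ → ClassicalSwing.State (n + 1)} (hc : (d.toModelD D a).IsSolutionOn c univ) {B : ℝ}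
    (hcoh : ∀ t, 0 ≤ t → ∀ i j, |(c t).1 i - (c t).1 j| ≤ B) :
    (∀ i, Tendsto (fun t => (c t).2 i) atTop (𝓝 (a * (∑ i, (d.M i : ℝ)) / ∑ i, D i))) ∧
      ∀ i, Tendsto (fun t => (d.toModelD D a).P i - D i * (a * (∑ i, (d.M i : ℝ)) / ∑ i, D i) -
        (d.toModelD D a).Pe (c t).1 i) atTop (𝓝 0) := by
  have hM' : ∀ i, 0 < (d.toModelD D a).M i := fun i => by
    rw [toModelD_M]; exact_mod_cast hM i
  have h := (d.toModelD D a).lossless_sync_of_cohesive (d.isLossless_toModelD hG D a)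
    (fun i j => d.B_symm_toModelD hB D a i j) hM' hD hc hcoh
  rw [d.syncFreq_toModelD hG hB D a] at h
  exact h

end RecastData

/-! ### WSCC9L — `WSCC9.postB_relL` (3 machines, h12 post-fault-B network, transfer conductances dropped) -/

namespace WSCC9

/-- **WSCC9L, ANY positive damping profile, any common acceleration**: from EVERY machine state in
`ℝ³ × ℝ³` exactly one global motion of `postB_relL.toModelD D a′`, and along it EITHER some rotor-angle
difference is unbounded on `t ≥ 0` OR all three speed deviations tend to `a′·ΣM/ΣD` and all three mismatches
`P_i − D_iω_s − P_ei(δ(t)) → 0`. Side conditions on the data (lossless, reciprocal, `M_i > 0`) by `decide`.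
MODELLED: MV-2L synthetic variant, not the printed WSCC 9-bus system.
[cite: Chiang1995, §3 Thm 3.1; Leonov2001, Ch. 4 §4.2 Thm 4.1; SauerPai1998, §7.9.3 eqs. (7.212)–(7.216)] -/
theorem postB_relL_dichotomy_anyDamping {D : Fin 3 → ℝ} (hD : ∀ i, 0 < D i) (a : ℝ)
    (x₀ : ClassicalSwing.State 3) :
    (∃! c : ℝ → ClassicalSwing.State 3, c 0 = x₀ ∧ (postB_relL.toModelD D a).IsSolutionOn c univ) ∧
      ∀ c : ℝ → ClassicalSwing.State 3, c 0 = x₀ → (postB_relL.toModelD D a).IsSolutionOn c univ →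
        ((∀ B : ℝ, ∃ t, 0 ≤ t ∧ ∃ i j, B < |(c t).1 i - (c t).1 j|) ∨
          ((∀ i, Tendsto (fun t => (c t).2 i) atTop (𝓝 (a * (∑ i, (postB_relL.M i : ℝ)) / ∑ i, D i))) ∧
            ∀ i, Tendsto (fun t => (postB_relL.toModelD D a).P i -
              D i * (a * (∑ i, (postB_relL.M i : ℝ)) / ∑ i, D i) -
              (postB_relL.toModelD D a).Pe (c t).1 i) atTop (𝓝 0))) :=
  have hM : ∀ i : Fin 3, 0 < postB_relL.M i := by decide +kernel
  postB_relL.dichotomy_toModelD postB_relL_transferConductance_eq_zero postB_relL_B_symm hM hD a x₀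

/-- **WSCC9L, cohesive motions synchronise** (any damping profile): bounded angle differences on `t ≥ 0`
⇒ all speeds `→ a′·ΣM/ΣD`, all mismatches `→ 0`.
[cite: Leonov2001, Ch. 4 §4.2 Thm 4.1; DorflerBullo2012, arXiv:0910.5673 §5.1 Thm 5.1] -/
theorem postB_relL_sync_of_cohesive {D : Fin 3 → ℝ} (hD : ∀ i, 0 < D i) (a : ℝ)
    {c : ℝ → ClassicalSwing.State 3} (hc : (postB_relL.toModelD D a).IsSolutionOn c univ) {B : ℝ}
    (hcoh : ∀ t, 0 ≤ t → ∀ i j, |(c t).1 i - (c t).1 j| ≤ B) :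
    (∀ i, Tendsto (fun t => (c t).2 i) atTop (𝓝 (a * (∑ i, (postB_relL.M i : ℝ)) / ∑ i, D i))) ∧
      ∀ i, Tendsto (fun t => (postB_relL.toModelD D a).P i -
        D i * (a * (∑ i, (postB_relL.M i : ℝ)) / ∑ i, D i) -
        (postB_relL.toModelD D a).Pe (c t).1 i) atTop (𝓝 0) :=
  have hM : ∀ i : Fin 3, 0 < postB_relL.M i := by decide +kernel
  postB_relL.sync_of_cohesive_toModelD postB_relL_transferConductance_eq_zero postB_relL_B_symm hM hD a
    hc hcoh

end WSCC9

/-! ### NE39L — `NE39L.data` (10 machines, h12 pre-fault network, all conductances dropped, lossless redispatch) -/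

namespace NE39L

/-- **NE39L, ANY positive damping profile, any common acceleration**: from EVERY machine state in
`ℝ¹⁰ × ℝ¹⁰` exactly one global motion of `NE39L.data.toModelD D a′`, and along it EITHER some rotor-angle
difference is unbounded on `t ≥ 0` OR all ten speed deviations tend to `a′·ΣM/ΣD` and all ten mismatches
`P_i − D_iω_s − P_ei(δ(t)) → 0`. Side conditions on the data by `decide`. MODELLED: MV-2L synthetic lossless
REDISPATCH variant (+ MV-RD, MV-h12, MV-E6), not the printed New England system.
[cite: Chiang1995, §3 Thm 3.1; Leonov2001, Ch. 4 §4.2 Thm 4.1; SauerPai1998, §7.9.3 eqs. (7.212)–(7.216)] -/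
theorem data_dichotomy_anyDamping {D : Fin 10 → ℝ} (hD : ∀ i, 0 < D i) (a : ℝ)
    (x₀ : ClassicalSwing.State 10) :
    (∃! c : ℝ → ClassicalSwing.State 10, c 0 = x₀ ∧ (data.toModelD D a).IsSolutionOn c univ) ∧
      ∀ c : ℝ → ClassicalSwing.State 10, c 0 = x₀ → (data.toModelD D a).IsSolutionOn c univ →
        ((∀ B : ℝ, ∃ t, 0 ≤ t ∧ ∃ i j, B < |(c t).1 i - (c t).1 j|) ∨
          ((∀ i, Tendsto (fun t => (c t).2 i) atTop (𝓝 (a * (∑ i, (data.M i : ℝ)) / ∑ i, D i))) ∧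
            ∀ i, Tendsto (fun t => (data.toModelD D a).P i -
              D i * (a * (∑ i, (data.M i : ℝ)) / ∑ i, D i) -
              (data.toModelD D a).Pe (c t).1 i) atTop (𝓝 0))) :=
  have hM : ∀ i : Fin 10, 0 < data.M i := by decide +kernel
  data.dichotomy_toModelD data_transferConductance_eq_zero data_B_symm hM hD a x₀

/-- **NE39L, cohesive motions synchronise** (any damping profile): bounded angle differences on `t ≥ 0`
⇒ all ten speeds `→ a′·ΣM/ΣD`, all mismatches `→ 0`.
[cite: Leonov2001, Ch. 4 §4.2 Thm 4.1; DorflerBullo2012, arXiv:0910.5673 §5.1 Thm 5.1] -/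
theorem data_sync_of_cohesive {D : Fin 10 → ℝ} (hD : ∀ i, 0 < D i) (a : ℝ)
    {c : ℝ → ClassicalSwing.State 10} (hc : (data.toModelD D a).IsSolutionOn c univ) {B : ℝ}
    (hcoh : ∀ t, 0 ≤ t → ∀ i j, |(c t).1 i - (c t).1 j| ≤ B) :
    (∀ i, Tendsto (fun t => (c t).2 i) atTop (𝓝 (a * (∑ i, (data.M i : ℝ)) / ∑ i, D i))) ∧
      ∀ i, Tendsto (fun t => (data.toModelD D a).P i -
        D i * (a * (∑ i, (data.M i : ℝ)) / ∑ i, D i) -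
        (data.toModelD D a).Pe (c t).1 i) atTop (𝓝 0) :=
  have hM : ∀ i : Fin 10, 0 < data.M i := by decide +kernel
  data.sync_of_cohesive_toModelD data_transferConductance_eq_zero data_B_symm hM hD a hc hcoh

end NE39L

end Summit.Ventures.GridStability.Models
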